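import Summits.Ventures.HodgeRepro2.T5BergmanLieModule
import Summits.Ventures.HodgeRepro2.T5Sl2LowestWeightModel

/-!
# The `K`-finite vectors of the weighted Bergman model ARE the abstract lowest-weight module

The polynomials `p = Σ aₙ zⁿ` (the `K`-finite vectors of the weight-`k` model) carry the differential
operators `E₊ = k z + z² ∂`, `E₋ = -∂`, `H = k + 2 z ∂` of `T5BergmanLieModule`; on coefficient sequences
`a : ℕ →₀ ℂ` these are the linear maps `Ep k`, `Fp`, `Hp k` (`raiseOp_ofCoeffs`, `lowerOp_ofCoeffs`,
`weightOp_ofCoeffs`). The rescaling `D k : single n c ↦ single n (c / ∏_{j<n} (k + j))` intertwines them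
with the operators `E₀`, `F₀ ℂ k`, `H₀ ℂ k` defining the abstract lowest-weight module `Model ℂ k` of
`T5Sl2LowestWeightModel` (`D_Ep`, `D_Fp`, `D_Hp`) and is a linear equivalence (`Dequiv`). Hence the
`K`-finite part of the explicit model, with its Lie-algebra action, IS the abstract module of lowest weight
`k` (`lie_e₀_toModel`, `lie_f₀_toModel`, `lie_h₀_toModel`: `⁅e₀, D a⁆ = D (E₊ a)`, `⁅f₀, D a⁆ = D (E₋ a)`,
`⁅h₀, D a⁆ = D (H a)`) — the identification left open in the lowest-weight lane (annex rows 103–110).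

Blind lane: Mathlib + the HodgeRepro2 prefix only; no sorry; axioms ⊆ {propext, Classical.choice,
Quot.sound}.
-/

namespace Summit.Ventures.HodgeRepro2.T5BergmanModelEquiv

open Finsupp T5BergmanLieModule T5Sl2LowestWeightModel

/-! ### Polynomials from coefficient sequences -/

/-- The polynomial `Σ aₙ zⁿ` with (finitely supported) coefficient sequence `a`, as a linear map. -/
noncomputable def ofCoeffs : (ℕ →₀ ℂ) →ₗ[ℂ] (ℂ → ℂ) :=
  Finsupp.lsum ℂ fun n => LinearMap.toSpanSingleton ℂ (ℂ → ℂ) (fun z => z ^ n)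

/-- `ofCoeffs (single n c) = c zⁿ`. -/
lemma ofCoeffs_single (n : ℕ) (c : ℂ) : ofCoeffs (single n c) = fun z => c * z ^ n := by
  unfold ofCoeffs
  rw [Finsupp.lsum_single, LinearMap.toSpanSingleton_apply]
  funext z
  simp

/-- `ofCoeffs a = Σ_{n ∈ supp a} aₙ zⁿ`, pointwise. -/
lemma ofCoeffs_apply (a : ℕ →₀ ℂ) (z : ℂ) : ofCoeffs a z = ∑ n ∈ a.support, a n * z ^ n := by
  unfold ofCoeffs
  rw [Finsupp.lsum_apply, Finsupp.sum, Finset.sum_apply]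
  refine Finset.sum_congr rfl fun n _ => ?_
  simp [LinearMap.toSpanSingleton_apply]

/-- `ofCoeffs a` as a finite sum of functions. -/
lemma ofCoeffs_eq_sum (a : ℕ →₀ ℂ) : ofCoeffs a = ∑ n ∈ a.support, fun z : ℂ => a n * z ^ n := by
  funext z
  rw [ofCoeffs_apply, Finset.sum_apply]

/-- The derivative of a polynomial: `Σ n aₙ z^{n-1}`. -/
lemma deriv_ofCoeffs (a : ℕ →₀ ℂ) (z : ℂ) :
    deriv (ofCoeffs a) z = ∑ n ∈ a.support, a n * ((n : ℂ) * z ^ (n - 1)) := by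
  rw [ofCoeffs_eq_sum, deriv_sum (A := fun n (z : ℂ) => a n * z ^ n) (fun n _ => by fun_prop)]
  refine Finset.sum_congr rfl fun n _ => ?_
  rw [deriv_const_mul _ (by fun_prop : DifferentiableAt ℂ (fun z : ℂ => z ^ n) z)]
  congr 1
  exact (hasDerivAt_pow n z).deriv

/-! ### The ladder on coefficient sequences -/

/-- `E₊` on coefficients: `single n c ↦ single (n+1) ((k + n) c)`. -/
noncomputable def Ep (k : ℕ) : (ℕ →₀ ℂ) →ₗ[ℂ] (ℕ →₀ ℂ) :=
  Finsupp.lsum ℂ fun n => LinearMap.toSpanSingleton ℂ (ℕ →₀ ℂ) (single (n + 1) ((k : ℂ) + n))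

/-- `E₋` on coefficients: `single n c ↦ single (n-1) (-n c)` (zero on `n = 0`). -/
noncomputable def Fp : (ℕ →₀ ℂ) →ₗ[ℂ] (ℕ →₀ ℂ) :=
  Finsupp.lsum ℂ fun n => LinearMap.toSpanSingleton ℂ (ℕ →₀ ℂ) (single (n - 1) (-(n : ℂ)))

/-- `H` on coefficients: `single n c ↦ single n ((k + 2n) c)`. -/
noncomputable def Hp (k : ℕ) : (ℕ →₀ ℂ) →ₗ[ℂ] (ℕ →₀ ℂ) :=
  Finsupp.lsum ℂ fun n => LinearMap.toSpanSingleton ℂ (ℕ →₀ ℂ) (single n ((k : ℂ) + 2 * n))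

/-- `Ep` on a single: `single n c ↦ single (n+1) (c (k + n))`. -/
lemma Ep_single (k n : ℕ) (c : ℂ) : Ep k (single n c) = single (n + 1) (c * ((k : ℂ) + n)) := by
  unfold Ep
  rw [Finsupp.lsum_single, LinearMap.toSpanSingleton_apply, smul_single, smul_eq_mul]

/-- `Fp` on a single: `single n c ↦ single (n-1) (-n c)`. -/
lemma Fp_single (n : ℕ) (c : ℂ) : Fp (single n c) = single (n - 1) (c * (-(n : ℂ))) := by
  unfold Fp
  rw [Finsupp.lsum_single, LinearMap.toSpanSingleton_apply, smul_single, smul_eq_mul]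

/-- `Hp` on a single: `single n c ↦ single n ((k + 2n) c)`. -/
lemma Hp_single (k n : ℕ) (c : ℂ) : Hp k (single n c) = single n (c * ((k : ℂ) + 2 * n)) := by
  unfold Hp
  rw [Finsupp.lsum_single, LinearMap.toSpanSingleton_apply, smul_single, smul_eq_mul]

/-- The image of a sum of singles under `ofCoeffs`, evaluated. -/
lemma ofCoeffs_lsum_apply (a : ℕ →₀ ℂ) (m : ℕ → ℕ) (c : ℕ → ℂ) (z : ℂ) :
    ofCoeffs ((Finsupp.lsum ℂ fun n => LinearMap.toSpanSingleton ℂ (ℕ →₀ ℂ) (single (m n) (c n))) a) z =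
      ∑ n ∈ a.support, a n * (c n * z ^ m n) := by
  rw [Finsupp.lsum_apply, map_finsuppSum, Finsupp.sum, Finset.sum_apply]
  refine Finset.sum_congr rfl fun n _ => ?_
  rw [LinearMap.toSpanSingleton_apply, map_smul, ofCoeffs_single]
  simp

/-- **`E₊` on polynomials is `Ep` on coefficients**: `E₊ (Σ aₙ zⁿ) = Σ (k+n) aₙ z^{n+1}`. -/
theorem raiseOp_ofCoeffs (k : ℕ) (a : ℕ →₀ ℂ) : raiseOp k (ofCoeffs a) = ofCoeffs (Ep k a) := by
  funext z
  unfold raiseOp Ep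
  rw [ofCoeffs_lsum_apply, ofCoeffs_apply, deriv_ofCoeffs, Finset.mul_sum, Finset.mul_sum,
    ← Finset.sum_add_distrib]
  refine Finset.sum_congr rfl fun n _ => ?_
  rcases n with _ | m
  · simp
    ring
  · simp only [Nat.add_sub_cancel, Nat.cast_succ]
    ring

/-- **`E₋` on polynomials is `Fp` on coefficients**. -/
theorem lowerOp_ofCoeffs (a : ℕ →₀ ℂ) : lowerOp (ofCoeffs a) = ofCoeffs (Fp a) := by
  funext z
  unfold lowerOp Fp
  rw [ofCoeffs_lsum_apply, deriv_ofCoeffs, ← Finset.sum_neg_distrib]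
  refine Finset.sum_congr rfl fun n _ => ?_
  ring

/-- **`H` on polynomials is `Hp` on coefficients**. -/
theorem weightOp_ofCoeffs (k : ℕ) (a : ℕ →₀ ℂ) : weightOp k (ofCoeffs a) = ofCoeffs (Hp k a) := by
  funext z
  unfold weightOp Hp
  rw [ofCoeffs_lsum_apply, ofCoeffs_apply, deriv_ofCoeffs, Finset.mul_sum, Finset.mul_sum,
    ← Finset.sum_add_distrib]
  refine Finset.sum_congr rfl fun n _ => ?_
  rcases n with _ | m
  · simp
    ring
  · simp only [Nat.add_sub_cancel, Nat.cast_succ]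
    ring

/-! ### The rescaling and the intertwining with `E₀`, `F₀`, `H₀` -/

/-- The rescaling factor `λₙ = (∏_{j<n} (k + j))⁻¹`. -/
noncomputable def lam (k n : ℕ) : ℂ := (∏ j ∈ Finset.range n, ((k : ℂ) + j))⁻¹

/-- `λ₀ = 1`. -/
lemma lam_zero (k : ℕ) : lam k 0 = 1 := by simp [lam]

/-- `λₙ ≠ 0` for `k ≥ 1` (every factor `k + j` is positive). -/
lemma lam_ne_zero (k : ℕ) (hk : 1 ≤ k) (n : ℕ) : lam k n ≠ 0 := by
  unfold lam
  refine inv_ne_zero (Finset.prod_ne_zero_iff.mpr fun j _ => ?_)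
  have : (1 : ℝ) ≤ k := by exact_mod_cast hk
  have h : (0 : ℝ) < (k : ℝ) + j := by positivity
  intro h0
  have := congrArg Complex.re h0
  simp at this
  linarith

/-- The recursion `(k + n) λ_{n+1} = λₙ`. -/
lemma lam_succ (k : ℕ) (hk : 1 ≤ k) (n : ℕ) : ((k : ℂ) + n) * lam k (n + 1) = lam k n := by
  have hne : ((k : ℂ) + n) ≠ 0 := by
    have : (1 : ℝ) ≤ k := by exact_mod_cast hk
    have h : (0 : ℝ) < (k : ℝ) + n := by positivity
    intro h0
    have := congrArg Complex.re h0
    simp at this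
    linarith
  unfold lam
  rw [Finset.prod_range_succ, mul_inv, mul_comm, mul_assoc, inv_mul_cancel₀ hne, mul_one]

/-- The rescaling `D k : single n c ↦ single n (λₙ c)`. -/
noncomputable def D (k : ℕ) : (ℕ →₀ ℂ) →ₗ[ℂ] (ℕ →₀ ℂ) :=
  Finsupp.lsum ℂ fun n => LinearMap.toSpanSingleton ℂ (ℕ →₀ ℂ) (single n (lam k n))

/-- Its inverse `single n c ↦ single n (λₙ⁻¹ c)`. -/
noncomputable def Dinv (k : ℕ) : (ℕ →₀ ℂ) →ₗ[ℂ] (ℕ →₀ ℂ) :=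
  Finsupp.lsum ℂ fun n => LinearMap.toSpanSingleton ℂ (ℕ →₀ ℂ) (single n (lam k n)⁻¹)

/-- `D` on a single. -/
lemma D_single (k n : ℕ) (c : ℂ) : D k (single n c) = single n (c * lam k n) := by
  unfold D
  rw [Finsupp.lsum_single, LinearMap.toSpanSingleton_apply, smul_single, smul_eq_mul]

/-- `Dinv` on a single. -/
lemma Dinv_single (k n : ℕ) (c : ℂ) : Dinv k (single n c) = single n (c * (lam k n)⁻¹) := by
  unfold Dinv
  rw [Finsupp.lsum_single, LinearMap.toSpanSingleton_apply, smul_single, smul_eq_mul]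

/-- **`D` intertwines `E₊` with `E₀`**: `D ∘ Ep = E₀ ∘ D` (for `k ≥ 1`). -/
theorem D_Ep (k : ℕ) (hk : 1 ≤ k) : D k ∘ₗ Ep k = E₀ ℂ ∘ₗ D k := by
  refine Finsupp.lhom_ext fun n c => ?_
  simp only [LinearMap.comp_apply]
  rw [Ep_single, D_single, D_single, E₀_single, mul_assoc, lam_succ k hk n]

/-- **`D` intertwines `E₋` with `F₀ ℂ k`**: `D ∘ Fp = F₀ ∘ D` (for `k ≥ 1`). -/
theorem D_Fp (k : ℕ) (hk : 1 ≤ k) : D k ∘ₗ Fp = F₀ ℂ (k : ℂ) ∘ₗ D k := by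
  refine Finsupp.lhom_ext fun n c => ?_
  simp only [LinearMap.comp_apply]
  rw [Fp_single, D_single, D_single]
  rcases n with _ | m
  · rw [Nat.zero_sub, Nat.cast_zero, neg_zero, mul_zero, zero_mul, single_zero, F₀_single_zero]
  · rw [F₀_single_succ, Nat.add_sub_cancel]
    congr 1
    have := lam_succ k hk m
    push_cast
    linear_combination ((m : ℂ) + 1) * c * this

/-- **`D` intertwines `H` with `H₀ ℂ k`**: `D ∘ Hp = H₀ ∘ D`. -/
theorem D_Hp (k : ℕ) : D k ∘ₗ Hp k = H₀ ℂ (k : ℂ) ∘ₗ D k := by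
  refine Finsupp.lhom_ext fun n c => ?_
  simp only [LinearMap.comp_apply]
  rw [Hp_single, D_single, D_single, H₀_single]
  congr 1
  ring

/-- `D k` is invertible (`k ≥ 1`). -/
theorem D_Dinv (k : ℕ) (hk : 1 ≤ k) : D k ∘ₗ Dinv k = LinearMap.id := by
  refine Finsupp.lhom_ext fun n c => ?_
  simp only [LinearMap.comp_apply, LinearMap.id_apply]
  rw [Dinv_single, D_single, mul_assoc, inv_mul_cancel₀ (lam_ne_zero k hk n), mul_one]

/-- `Dinv k ∘ D k = id` (`k ≥ 1`). -/
theorem Dinv_D (k : ℕ) (hk : 1 ≤ k) : Dinv k ∘ₗ D k = LinearMap.id := by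
  refine Finsupp.lhom_ext fun n c => ?_
  simp only [LinearMap.comp_apply, LinearMap.id_apply]
  rw [D_single, Dinv_single, mul_assoc, mul_inv_cancel₀ (lam_ne_zero k hk n), mul_one]

/-- **The linear equivalence** between coefficient sequences (the `K`-finite vectors) and the abstract
module's underlying space. -/
noncomputable def Dequiv (k : ℕ) (hk : 1 ≤ k) : (ℕ →₀ ℂ) ≃ₗ[ℂ] (ℕ →₀ ℂ) :=
  LinearEquiv.ofLinear (D k) (Dinv k) (D_Dinv k hk) (Dinv_D k hk)

/-- `Dequiv k` is `D k` as a function. -/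
lemma Dequiv_apply (k : ℕ) (hk : 1 ≤ k) (a : ℕ →₀ ℂ) : Dequiv k hk a = D k a := rfl

/-! ### The Lie-algebra action on `Model ℂ k` -/

/-- Coefficient sequences as elements of the abstract module `Model ℂ k`. -/
def toModel (k : ℕ) (a : ℕ →₀ ℂ) : Model ℂ (k : ℂ) := a

/-- **`⁅e₀, D a⁆ = D (E₊ a)`** in `Model ℂ k`: the raising operator of the explicit model is the action
of `e₀ ∈ sl₂(ℂ)` on the abstract module. -/
theorem lie_e₀_toModel (k : ℕ) (hk : 1 ≤ k) (a : ℕ →₀ ℂ) :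
    ⁅T5Sl2Standard.e₀ ℂ, toModel k (D k a)⁆ = toModel k (D k (Ep k a)) := by
  rw [lie_eq, rho_e₀]
  show E₀ ℂ (D k a) = D k (Ep k a)
  have := congrArg (fun L => L a) (D_Ep k hk)
  simpa using this.symm

/-- **`⁅f₀, D a⁆ = D (E₋ a)`** in `Model ℂ k`. -/
theorem lie_f₀_toModel (k : ℕ) (hk : 1 ≤ k) (a : ℕ →₀ ℂ) :
    ⁅T5Sl2Standard.f₀ ℂ, toModel k (D k a)⁆ = toModel k (D k (Fp a)) := by
  rw [lie_eq, rho_f₀]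
  show F₀ ℂ (k : ℂ) (D k a) = D k (Fp a)
  have := congrArg (fun L => L a) (D_Fp k hk)
  simpa using this.symm

/-- **`⁅h₀, D a⁆ = D (H a)`** in `Model ℂ k`. -/
theorem lie_h₀_toModel (k : ℕ) (a : ℕ →₀ ℂ) :
    ⁅T5Sl2Standard.h₀ ℂ, toModel k (D k a)⁆ = toModel k (D k (Hp k a)) := by
  rw [lie_eq, rho_h₀]
  show H₀ ℂ (k : ℂ) (D k a) = D k (Hp k a)
  have := congrArg (fun L => L a) (D_Hp k)
  simpa using this.symm

/-- The lowest-weight vector `1 = z⁰` corresponds to the generator `v 0` of the abstract module. -/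
theorem D_single_zero_one (k : ℕ) : toModel k (D k (single 0 1)) = v ℂ (k : ℂ) 0 := by
  show D k (single 0 1) = single 0 1
  rw [D_single, lam_zero, mul_one]

/-- **The monomials correspond to the `e₀`-string**: `D (zⁿ) = λₙ · (single n 1)`, the `n`-th basis
vector of the abstract module scaled by `λₙ`. -/
theorem D_single_one (k n : ℕ) : D k (single n 1) = single n (lam k n) := by
  rw [D_single, one_mul]

end Summit.Ventures.HodgeRepro2.T5BergmanModelEquiv
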